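import Mathlib
import Literature.MathematicalPhysics.QuantumFieldTheory.Balaban1983to89.B14

/-!
# `Balaban1983to89.B14Thm2` — [Balaban1988Convergent] Theorem 2 (p. 263): the inequalities (2.43), (2.44) NAMED, and the
printed summations (2.43) ⇒ (2.45), (2.44) ⇒ (2.46)₁, (2.47) ⇒ (2.48) KERNEL-CHECKED

CITATION HEADER (lean-in-tree rule 2026-08-18).  Source: T. Bałaban, *Convergent renormalization expansions for lattice
gauge theories*, Commun. Math. Phys. **119**, 243–285 (1988), doi:10.1007/bf01217741 (cell paper B14; held:
`paper:balaban1988-cmp119-convergent-renormalization`; journal page = PDF page + 242; quotations below are read from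
the page renders, pp. 259–264).  WHAT IS REPRODUCED (statement level, surge node T11.3 "sharpen"): (a) the two displayed
inequalities of Theorem 2 as SEPARATE named Props `Ineq243`, `Ineq244` over the sibling module's carrier
`B14.Sect2Data` (in `B14.Thm2Printed` they are the two inlined conjuncts; `thm2Printed_iff` records, by `Iff.rfl`, that
`B14.Thm2Printed` is literally "β < 1 → ∃ E₁ R₁, ∀ run, hypotheses → Ineq243 ∧ Ineq244"); (b) the displayed per-scale
boundary-term bound (2.47) p. 264 as `Ineq247`; (c) KERNEL-CHECKED RE-DERIVATIONS of the three elementary summation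
steps printed on pp. 263–264 — *"Taking Ω = Bʲ(Λ_j⁰), φ = φ_j in (2.43), and summing the obtained inequalities over j,
we get"* (2.45); *"Similarly, taking Ω = Bʲ(Λ_j⁰) in (2.44), and summing over j, we get"* the FIRST inequality of (2.46);
*"Summing over j from n to k, and then over n from 1 to k, we get"* (2.48) — as theorems over per-scale real sequences
(`bound245_of_243`, `bound246a_of_244`, `bound248_of_247`), assembled into the sibling module's `B14.Bounds245to249`
(`bounds245to249_of_perScale`).  The exchange of the order of summation over the triangle `1 ≤ j ≤ n ≤ k`
(`sum_triangle_comm`), the geometric sums `Σ_{j=1}^{n} (L^{j−n})^β ≤ (1 − L^{−β})^{−1}` (`inner_geom_le`, from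
`B14.geomStep_245`) and `Σ_{j=n}^{k} 2^{−(j−n)} ≤ 2` (`inner_dyadic_le`) are the whole content.
REVISION v2 (node T11.3 pass 2) adds the closing step of the chain: (2.23) p. 258 (`Eq223`, scalar shape of
the general form of the effective action), the vacuum-energy sentence p. 264 as an explicit hypothesis
(`VacuumRestBound`), (2.49) p. 264 (`Ineq249`, with the typed reading of its "O(1)"), and the kernel-checked
*"These bounds yield"* (2.49): `ineq249_of_223` (constant `E₁(1−L^{−β})^{−1} + 1 + 2B₁ + E₂`), `ineq249_of_perScale`,
plus the pointwise exponential form `exp_action_two_sided` consumed by node T11.4 ((2.50), unit pv06).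
WHAT IS *NOT* REPRODUCED OR ASSERTED: (2.43), (2.44), (2.47) themselves, nor the vacuum-energy bound of p. 264 (proved in §3 of the paper and in [I] §§3–4 —
they enter only as hypotheses); the MIDDLE and LAST members of (2.46), `R₁ Σ_n |Γ_n| Σ_{j≤n} g_j^{κ₀} < R₁ Σ_n |Γ_n|
g_n^{κ₀−6} < Σ_n |Γ_n|` *"for κ₀ ≥ 7 and g sufficiently small"*, which consume running/summability information on the
couplings (cell GAPS.md G-f2.1; `…Balaban1983to89.Step.sum_sixth_powers_le`, `….interval_hyp_not_sufficient_for_2_46`;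
located step T11.F of the cell's claim table) — here they are the EXPLICIT hypotheses `hsum`, `hsmall` of
`bound246_of_244`, nothing more.  DICTIONARY (docstrings): `e j` = the j-th summand of (2.25) p. 259, which by (2.26)
(`𝐄^{(j)}(Λ_j,U_k) = Σ_{z∈Λ_j⁰} 𝐄^{(j)}(Λ_j,U_k,z)`) is the left-hand side of (2.43) at `Ω = Bʲ(Λ_j⁰)` (so that
`Λ_j⁰ ∩ Ω = Λ_j⁰`), `φ = φ_j`; `r j` = the j-th summand of (2.30) p. 260; `b j n` = `𝐁^{(j,n)}(U_k,A,{S_i})` of (2.47);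
`Γ n` = `|Γ_n|` (number of points of `Γ_n ⊂ T₁^{(n)}`, (2.2) p. 255), which majorises `|Γ_n ∩ Ω|` for every Ω; `V n` =
the volume printed in the `j = n` clause of (2.47) (`|Γ_n|` for `n < k`, `|Γ_k ∖ Λ_k⁰|` for `n = k`).  LOCATED
OBSERVATIONS (cell GAPS.md row G-pv01-1, not adjudications of truth): (i) the symbol `𝐁^{(j,n)}` of (2.47) is not
defined in §2 ((2.40)–(2.42) p. 261 define `𝐁^{(j)}` and its X-sum only); the printed summation presupposes
`𝐁_k = Σ_{n=1}^{k} Σ_{j=n}^{k} 𝐁^{(j,n)}`, which is how `Btot` enters below; (ii) at `Ω = Bʲ(Λ_j⁰)` the left-hand side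
of (2.44) sums over `{X ∈ 𝐃_j : X ⊂ Λ_j, X ∩ Ω ≠ ∅}`, whereas the j-th summand of (2.30) sums over
`{X ∈ 𝐃_j : X ⊂ Λ_j^{~−1}}` (p. 260) — the typed step takes the bound for the (2.30) summand as its hypothesis and
records the identification as the reader's; (ii′) (G-pv01-2) "the terms logarithmic in coupling constants" of E_k and the
bound on the rest of E_k are asserted on p. 264 without statement of the constant — typed as the hypothesis
`VacuumRestBound`; (iii) `0 < β` is used by (2.45) (Theorem 2 prints only *"for β < 1"*;
p. 261 prints, of the β of the regularity conditions (2.34)–(2.39), *"The number β is a small positive constant"*).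
NOTHING of the series is asserted; value = typed skeleton + located gaps, NOT summit progress.  Unit `b2b-balaban-pv01`
(surge node prover #01); companion rows: cell `GAPS.md` G-pv01-1 / C-pv01-1, `DIVERGENCE.md` D-pv01.1.
-/

namespace Literature.MathematicalPhysics.QuantumFieldTheory.Balaban1983to89.B14Thm2

open Literature.MathematicalPhysics.QuantumFieldTheory.Balaban1983to89

/-! ## (2.43), (2.44) named -/

/-- **(2.43)** of Theorem 2, verbatim (p. 263 [21]): *"there exists a constant E₁ independent of j, k, Ω, {Ω_j}, {Λ_j},
T (but dependent on the other constants occurring in the formulation of this theorem), such that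
| Σ_{z∈Λ_j⁰∩Ω} [𝐄^{(j)}(Λ_j, U_k, z) − 𝐄^{(j)}(Λ_j, 1, z)] − β_j(g_{j−1}) A(φ, U_k) | ≤ E₁ Σ_{n=j}^{k} (L^{j−n})^β |Γ_n∩Ω| ,
(2.43) for β < 1, and sufficiently regular configurations U_k = U_k(V) … The volumes are taken in the corresponding
scales, i.e. |Γ_n∩Ω| means the number of points in the set Γ_n∩Ω ⊂ T₁^{(n)}."*  Typed for ONE run `S` and given
constants `L, β, E₁`: the first conjunct of `B14.Thm2Printed` (`S.eTerm j k ω` = the left-hand side, `S.gammaVol n ω` =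
`|Γ_n ∩ Ω|`, `ω` ranging over the admissible data (Ω, φ, U_k)). [cite: Balaban1988Convergent, (2.43) p.263] -/
def Ineq243 (S : B14.Sect2Data) (L β E₁ : ℝ) : Prop :=
  ∀ j k ω, 1 ≤ j → j ≤ k → k ≤ S.K →
    |S.eTerm j k ω| ≤ E₁ * ∑ n ∈ Finset.Icc j k, (L ^ ((j : ℝ) - n)) ^ β * S.gammaVol n ω

/-- **(2.44)** of Theorem 2, verbatim (p. 263 [21]): *"Similarly, there exists an absolute constant R₁ such, that
| Σ_{X∈𝐃_j, X⊂Λ_j, X∩Ω≠∅} [𝐑^{(j)}(X, U_k) − 𝐑^{(j)}(X, 1)] | ≤ R₁ g_j^{κ₀} Σ_{n=j}^{k} |Γ_n∩Ω| , (2.44) for the regular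
configurations U_k. (In fact the constant R₁ can be taken as equal to 1 for g_j sufficiently small.)"*  Typed for ONE
run `S` and given `R₁, κ₀`: the second conjunct of `B14.Thm2Printed` (`S.rTerm j k ω` = the left-hand side). [cite: Balaban1988Convergent, (2.44) p.263] -/
def Ineq244 (S : B14.Sect2Data) (R₁ : ℝ) (κ₀ : ℕ) : Prop :=
  ∀ j k ω, 1 ≤ j → j ≤ k → k ≤ S.K →
    |S.rTerm j k ω| ≤ R₁ * (S.flow.g j) ^ κ₀ * ∑ n ∈ Finset.Icc j k, S.gammaVol n ω

/-- Bookkeeping (by `Iff.rfl`): the sibling module's `B14.Thm2Printed` IS "β < 1 → ∃ E₁ R₁, for every run of the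
family, under the hypotheses of Theorem 1, (2.43) ∧ (2.44)" with the two inequalities named. [folklore] -/
theorem thm2Printed_iff (H033 : Flow → ℕ → Prop) {I : Type} (fam : I → B14.Sect2Data) (L β : ℝ) (κ₀ : ℕ) :
    B14.Thm2Printed H033 fam L β κ₀ ↔
      (β < 1 → ∃ E₁ R₁ : ℝ, ∀ i : I, (fam i).flow.SatisfiesRG (fam i).K → H033 (fam i).flow (fam i).K →
        Ineq243 (fam i) L β E₁ ∧ Ineq244 (fam i) R₁ κ₀) :=
  Iff.rfl

/-- **(2.47)** p. 264 [22], verbatim with its context (p. 263 bottom – p. 264 top): *"Bounds for the boundary terms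
(2.40) are even more elementary. We use the exponential factor exp(−(κ−1)d_j(X)) from the inequality (2.42) to control
the sum over X in (2.41). The remaining factor exp(−d_j(X)) is used to get an additional small factor, e.g. for j > n
it can be bounded by 2^{−(j−1−n)}. Thus we obtain |𝐁^{(j,n)}(U_k, A, {S_i})| ≤ B₁ 2^{−(j−n)} |Γ_n| (2.47) for j > n,
and this inequality with |Γ_n∖Λ_k⁰| for j = n."*  Typed over real sequences: `b j n` = `𝐁^{(j,n)}(U_k,A,{S_i})` (a
symbol not defined in §2 — cell GAPS.md G-pv01-1 (i)), `V n` = the printed volume factor majorising both clauses at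
scale n (`|Γ_n|` for `n < k`, since `|Γ_n∖Λ_k⁰| ≤ |Γ_n|`; `|Γ_k∖Λ_k⁰|` for `n = k`, where only `j = n = k` occurs),
for `1 ≤ n ≤ j ≤ k`. [cite: Balaban1988Convergent, (2.47) p.264] -/
def Ineq247 (b : ℕ → ℕ → ℝ) (B₁ : ℝ) (V : ℕ → ℝ) (k : ℕ) : Prop :=
  ∀ n j, 1 ≤ n → n ≤ j → j ≤ k → |b j n| ≤ B₁ * (2 : ℝ) ^ (-((j : ℝ) - n)) * V n

/-! ## Elementary summation lemmas (the whole content of the printed steps) -/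

/-- Exchange of the order of summation over the triangle `1 ≤ j ≤ n ≤ k`:
`Σ_{j=1}^{k} Σ_{n=j}^{k} f(j,n) = Σ_{n=1}^{k} Σ_{j=1}^{n} f(j,n)`. [folklore] -/
theorem sum_triangle_comm (k : ℕ) (f : ℕ → ℕ → ℝ) :
    ∑ j ∈ Finset.Icc 1 k, ∑ n ∈ Finset.Icc j k, f j n =
      ∑ n ∈ Finset.Icc 1 k, ∑ j ∈ Finset.Icc 1 n, f j n := by
  apply Finset.sum_comm'
  intro j n
  simp only [Finset.mem_Icc]
  omega

/-- For `L > 0` and `j ≤ n`: `(L^{j−n})^β = (L^{−β})^{n−j}` (real powers on the left, a natural power on the right).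
[folklore] -/
theorem rpow_scale_eq (L β : ℝ) (hL : 0 < L) {j n : ℕ} (hjn : j ≤ n) :
    (L ^ ((j : ℝ) - n)) ^ β = (L ^ (-β)) ^ (n - j) := by
  have h1 : (L ^ ((j : ℝ) - n)) ^ β = L ^ (((j : ℝ) - n) * β) := (Real.rpow_mul hL.le _ _).symm
  have h2 : (L ^ (-β)) ^ (n - j) = L ^ (-β * ((n - j : ℕ) : ℝ)) := by
    rw [← Real.rpow_natCast, ← Real.rpow_mul hL.le]
  rw [h1, h2, Nat.cast_sub hjn]
  congr 1
  ring

/-- For `a > 0` and `n ≤ j`: `a^{−(j−n)} = (a⁻¹)^{j−n}` (real power on the left, natural power on the right). [folklore] -/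
theorem rpow_neg_sub_eq (a : ℝ) (ha : 0 < a) {n j : ℕ} (hnj : n ≤ j) :
    a ^ (-((j : ℝ) - n)) = (a⁻¹) ^ (j - n) := by
  rw [Real.rpow_neg ha.le, inv_pow, ← Nat.cast_sub hnj, Real.rpow_natCast]

/-- Re-indexing `i = n − j`: `Σ_{j=1}^{n} q^{n−j} = Σ_{i=0}^{n−1} q^i`. [folklore] -/
theorem sum_Icc_pow_sub_eq (q : ℝ) (n : ℕ) :
    ∑ j ∈ Finset.Icc 1 n, q ^ (n - j) = ∑ i ∈ Finset.range n, q ^ i := by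
  refine Finset.sum_nbij' (fun j => n - j) (fun i => n - i) ?_ ?_ ?_ ?_ ?_
  · intro j hj
    rw [Finset.mem_Icc] at hj
    rw [Finset.mem_range]
    omega
  · intro i hi
    rw [Finset.mem_range] at hi
    rw [Finset.mem_Icc]
    omega
  · intro j hj
    rw [Finset.mem_Icc] at hj
    show n - (n - j) = j
    omega
  · intro i hi
    rw [Finset.mem_range] at hi
    show n - (n - i) = i
    omega
  · intro j _
    rfl

/-- Re-indexing `i = j − n`: `Σ_{j=n}^{k} q^{j−n} = Σ_{i=0}^{k−n} q^i` (both sides empty if `n > k`). [folklore] -/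
theorem sum_Icc_pow_sub_left_eq (q : ℝ) (n k : ℕ) :
    ∑ j ∈ Finset.Icc n k, q ^ (j - n) = ∑ i ∈ Finset.range (k + 1 - n), q ^ i := by
  refine Finset.sum_nbij' (fun j => j - n) (fun i => i + n) ?_ ?_ ?_ ?_ ?_
  · intro j hj
    rw [Finset.mem_Icc] at hj
    rw [Finset.mem_range]
    omega
  · intro i hi
    rw [Finset.mem_range] at hi
    rw [Finset.mem_Icc]
    omega
  · intro j hj
    rw [Finset.mem_Icc] at hj
    show j - n + n = j
    omega
  · intro i _
    show i + n - n = i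
    omega
  · intro j _
    rfl

/-- The geometric step of **(2.45)** in printed form: for `L > 1`, `β > 0` and every `n`,
`Σ_{j=1}^{n} (L^{j−n})^β ≤ (1 − L^{−β})^{−1}` (print: "<"; equality of the typed "≤" is never attained but "≤" is what
is consumed).  From `B14.geomStep_245` with `q = L^{−β}`. [cite: Balaban1988Convergent, (2.45) p.263] -/
theorem inner_geom_le (L β : ℝ) (hL : 1 < L) (hβ : 0 < β) (n : ℕ) :
    ∑ j ∈ Finset.Icc 1 n, (L ^ ((j : ℝ) - n)) ^ β ≤ (1 - L ^ (-β))⁻¹ := by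
  have hL0 : 0 < L := lt_trans zero_lt_one hL
  have hq0 : 0 ≤ L ^ (-β) := Real.rpow_nonneg hL0.le _
  have hq1 : L ^ (-β) < 1 := Real.rpow_lt_one_of_one_lt_of_neg hL (by linarith)
  calc ∑ j ∈ Finset.Icc 1 n, (L ^ ((j : ℝ) - n)) ^ β
      = ∑ j ∈ Finset.Icc 1 n, (L ^ (-β)) ^ (n - j) := by
        refine Finset.sum_congr rfl fun j hj => ?_
        rw [Finset.mem_Icc] at hj
        exact rpow_scale_eq L β hL0 hj.2
    _ = ∑ i ∈ Finset.range n, (L ^ (-β)) ^ i := sum_Icc_pow_sub_eq _ n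
    _ ≤ (1 - L ^ (-β))⁻¹ := B14.geomStep_245 _ hq0 hq1 n

/-- The dyadic step of **(2.48)**: `Σ_{j=n}^{k} 2^{−(j−n)} ≤ 2` (print: the factor 2 in "2B₁"). [cite: Balaban1988Convergent, (2.48) p.264] -/
theorem inner_dyadic_le (n k : ℕ) :
    ∑ j ∈ Finset.Icc n k, (2 : ℝ) ^ (-((j : ℝ) - n)) ≤ 2 := by
  have h2 : (0 : ℝ) < 2 := by norm_num
  calc ∑ j ∈ Finset.Icc n k, (2 : ℝ) ^ (-((j : ℝ) - n))
      = ∑ j ∈ Finset.Icc n k, ((2 : ℝ)⁻¹) ^ (j - n) := by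
        refine Finset.sum_congr rfl fun j hj => ?_
        rw [Finset.mem_Icc] at hj
        exact rpow_neg_sub_eq 2 h2 hj.1
    _ = ∑ i ∈ Finset.range (k + 1 - n), ((2 : ℝ)⁻¹) ^ i := sum_Icc_pow_sub_left_eq _ n k
    _ ≤ (1 - (2 : ℝ)⁻¹)⁻¹ := B14.geomStep_245 _ (by norm_num) (by norm_num) _
    _ = 2 := by norm_num

/-! ## (2.43) ⇒ (2.45) -/

/-- **(2.43) summed over j gives (2.45)** (p. 263 [21]): *"Taking Ω = Bʲ(Λ_j⁰), φ = φ_j in (2.43), and summing the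
obtained inequalities over j, we get |𝐄_k(U_k)| ≤ E₁ Σ_{n=1}^{k} |Γ_n| Σ_{j=1}^{n} (L^{j−n})^β < E₁ (1 − L^{−β})^{−1}
Σ_{n=1}^{k} |Γ_n| . (2.45)"*  Typed over real sequences: `e j` = the j-th summand of (2.25) (= the left-hand side of
(2.43) at that Ω, φ, by (2.26)), `Γ n ≥ 0` any majorant of `|Γ_n ∩ Ω|` (e.g. `|Γ_n|`), `E₁ ≥ 0`, `L > 1`, `β > 0`;
hypothesis `h243` = the instances of (2.43), `j = 1,…,k`; conclusion = both displayed members of (2.45) (with "≤").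
Content: `|Σ_j e_j| ≤ Σ_j |e_j|`, exchange of summation over `1 ≤ j ≤ n ≤ k`, and `inner_geom_le`. [cite: Balaban1988Convergent, (2.45) p.263] -/
theorem bound245_of_243 (k : ℕ) (e : ℕ → ℝ) (Γ : ℕ → ℝ) (E₁ L β : ℝ)
    (hL : 1 < L) (hβ : 0 < β) (hE : 0 ≤ E₁) (hΓ : ∀ n, 1 ≤ n → n ≤ k → 0 ≤ Γ n)
    (h243 : ∀ j, 1 ≤ j → j ≤ k →
      |e j| ≤ E₁ * ∑ n ∈ Finset.Icc j k, (L ^ ((j : ℝ) - n)) ^ β * Γ n) :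
    |∑ j ∈ Finset.Icc 1 k, e j| ≤
        E₁ * ∑ n ∈ Finset.Icc 1 k, Γ n * ∑ j ∈ Finset.Icc 1 n, (L ^ ((j : ℝ) - n)) ^ β ∧
      E₁ * ∑ n ∈ Finset.Icc 1 k, Γ n * ∑ j ∈ Finset.Icc 1 n, (L ^ ((j : ℝ) - n)) ^ β ≤
        E₁ * (1 - L ^ (-β))⁻¹ * ∑ n ∈ Finset.Icc 1 k, Γ n := by
  have step1 : |∑ j ∈ Finset.Icc 1 k, e j| ≤ ∑ j ∈ Finset.Icc 1 k, |e j| :=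
    Finset.abs_sum_le_sum_abs _ _
  have step2 : ∑ j ∈ Finset.Icc 1 k, |e j| ≤
      ∑ j ∈ Finset.Icc 1 k, E₁ * ∑ n ∈ Finset.Icc j k, (L ^ ((j : ℝ) - n)) ^ β * Γ n := by
    refine Finset.sum_le_sum fun j hj => ?_
    rw [Finset.mem_Icc] at hj
    exact h243 j hj.1 hj.2
  have step3 : ∑ j ∈ Finset.Icc 1 k, E₁ * ∑ n ∈ Finset.Icc j k, (L ^ ((j : ℝ) - n)) ^ β * Γ n =
      E₁ * ∑ n ∈ Finset.Icc 1 k, Γ n * ∑ j ∈ Finset.Icc 1 n, (L ^ ((j : ℝ) - n)) ^ β := by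
    rw [← Finset.mul_sum, sum_triangle_comm k (fun j n => (L ^ ((j : ℝ) - n)) ^ β * Γ n)]
    congr 1
    refine Finset.sum_congr rfl fun n _ => ?_
    rw [Finset.mul_sum]
    refine Finset.sum_congr rfl fun j _ => ?_
    ring
  refine ⟨le_trans step1 (le_trans step2 step3.le), ?_⟩
  have hinner : ∀ n ∈ Finset.Icc 1 k,
      Γ n * ∑ j ∈ Finset.Icc 1 n, (L ^ ((j : ℝ) - n)) ^ β ≤ Γ n * (1 - L ^ (-β))⁻¹ := by
    intro n hn
    rw [Finset.mem_Icc] at hn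
    exact mul_le_mul_of_nonneg_left (inner_geom_le L β hL hβ n) (hΓ n hn.1 hn.2)
  calc E₁ * ∑ n ∈ Finset.Icc 1 k, Γ n * ∑ j ∈ Finset.Icc 1 n, (L ^ ((j : ℝ) - n)) ^ β
      ≤ E₁ * ∑ n ∈ Finset.Icc 1 k, Γ n * (1 - L ^ (-β))⁻¹ :=
        mul_le_mul_of_nonneg_left (Finset.sum_le_sum hinner) hE
    _ = E₁ * (1 - L ^ (-β))⁻¹ * ∑ n ∈ Finset.Icc 1 k, Γ n := by
        rw [← Finset.sum_mul]
        ring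

/-! ## (2.44) ⇒ (2.46), first member; the other members as explicit hypotheses -/

/-- **(2.44) summed over j gives the FIRST member of (2.46)** (p. 263 [21]): *"Similarly, taking Ω = Bʲ(Λ_j⁰) in
(2.44), and summing over j, we get |𝐑_k(U_k)| ≤ R₁ Σ_{n=1}^{k} |Γ_n| Σ_{j=1}^{n} g_j^{κ₀}"*.  Typed over real sequences:
`r j` = the j-th summand of (2.30) p. 260 (its X-sum runs over `X ⊂ Λ_j^{~−1}`; the identification with the
left-hand side of (2.44) at `Ω = Bʲ(Λ_j⁰)` is the reader's — cell GAPS.md G-pv01-1 (ii)), `g j` = `g_j`, `Γ n` any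
majorant of `|Γ_n ∩ Ω|`; hypothesis `h244` = the instances of (2.44), `j = 1,…,k`.  Pure algebra after the termwise
bounds (no sign hypotheses). [cite: Balaban1988Convergent, (2.46) p.263] -/
theorem bound246a_of_244 (k κ₀ : ℕ) (r : ℕ → ℝ) (Γ g : ℕ → ℝ) (R₁ : ℝ)
    (h244 : ∀ j, 1 ≤ j → j ≤ k → |r j| ≤ R₁ * (g j) ^ κ₀ * ∑ n ∈ Finset.Icc j k, Γ n) :
    |∑ j ∈ Finset.Icc 1 k, r j| ≤
      R₁ * ∑ n ∈ Finset.Icc 1 k, Γ n * ∑ j ∈ Finset.Icc 1 n, (g j) ^ κ₀ := by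
  have step1 : |∑ j ∈ Finset.Icc 1 k, r j| ≤ ∑ j ∈ Finset.Icc 1 k, |r j| :=
    Finset.abs_sum_le_sum_abs _ _
  have step2 : ∑ j ∈ Finset.Icc 1 k, |r j| ≤
      ∑ j ∈ Finset.Icc 1 k, R₁ * (g j) ^ κ₀ * ∑ n ∈ Finset.Icc j k, Γ n := by
    refine Finset.sum_le_sum fun j hj => ?_
    rw [Finset.mem_Icc] at hj
    exact h244 j hj.1 hj.2
  have step3 : ∑ j ∈ Finset.Icc 1 k, R₁ * (g j) ^ κ₀ * ∑ n ∈ Finset.Icc j k, Γ n =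
      R₁ * ∑ n ∈ Finset.Icc 1 k, Γ n * ∑ j ∈ Finset.Icc 1 n, (g j) ^ κ₀ := by
    have hre : ∀ j ∈ Finset.Icc 1 k, R₁ * (g j) ^ κ₀ * ∑ n ∈ Finset.Icc j k, Γ n =
        R₁ * ∑ n ∈ Finset.Icc j k, (g j) ^ κ₀ * Γ n := by
      intro j _
      rw [mul_assoc, Finset.mul_sum]
    rw [Finset.sum_congr rfl hre, ← Finset.mul_sum, sum_triangle_comm k (fun j n => (g j) ^ κ₀ * Γ n)]
    congr 1
    refine Finset.sum_congr rfl fun n _ => ?_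
    rw [Finset.mul_sum]
    refine Finset.sum_congr rfl fun j _ => ?_
    ring
  exact le_trans step1 (le_trans step2 step3.le)

/-- **(2.46)** as consumed by `B14.Bounds245to249`, from (2.44) AND the two located further inputs made explicit:
`hsum` = the middle inequality *"Σ_{j=1}^{n} g_j^{κ₀} < g_n^{κ₀−6}"* (which needs running/summability of the couplings,
not the interval hypothesis alone — `…Step.interval_hyp_not_sufficient_for_2_46`, `…Step.sum_sixth_powers_le`; cell
GAPS.md G-f2.1, claim-table step T11.F) and `hsmall` = *"g sufficiently small"* in the form `R₁ g_n^{κ₀−6} ≤ 1` that the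
last inequality *"< Σ_{n=1}^{k} |Γ_n|"* uses; `Γ n ≥ 0`, `R₁ ≥ 0`.  Nothing about the couplings is asserted. [cite: Balaban1988Convergent, (2.46) p.263] -/
theorem bound246_of_244 (k κ₀ : ℕ) (r : ℕ → ℝ) (Γ g : ℕ → ℝ) (R₁ : ℝ) (hR : 0 ≤ R₁)
    (hΓ : ∀ n, 1 ≤ n → n ≤ k → 0 ≤ Γ n)
    (h244 : ∀ j, 1 ≤ j → j ≤ k → |r j| ≤ R₁ * (g j) ^ κ₀ * ∑ n ∈ Finset.Icc j k, Γ n)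
    (hsum : ∀ n, 1 ≤ n → n ≤ k → ∑ j ∈ Finset.Icc 1 n, (g j) ^ κ₀ ≤ (g n) ^ (κ₀ - 6))
    (hsmall : ∀ n, 1 ≤ n → n ≤ k → R₁ * (g n) ^ (κ₀ - 6) ≤ 1) :
    |∑ j ∈ Finset.Icc 1 k, r j| ≤ R₁ * ∑ n ∈ Finset.Icc 1 k, Γ n * (g n) ^ (κ₀ - 6) ∧
      R₁ * ∑ n ∈ Finset.Icc 1 k, Γ n * (g n) ^ (κ₀ - 6) ≤ ∑ n ∈ Finset.Icc 1 k, Γ n := by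
  refine ⟨le_trans (bound246a_of_244 k κ₀ r Γ g R₁ h244) ?_, ?_⟩
  · refine mul_le_mul_of_nonneg_left (Finset.sum_le_sum fun n hn => ?_) hR
    rw [Finset.mem_Icc] at hn
    exact mul_le_mul_of_nonneg_left (hsum n hn.1 hn.2) (hΓ n hn.1 hn.2)
  · rw [Finset.mul_sum]
    refine Finset.sum_le_sum fun n hn => ?_
    rw [Finset.mem_Icc] at hn
    have h := mul_le_mul_of_nonneg_left (hsmall n hn.1 hn.2) (hΓ n hn.1 hn.2)
    calc R₁ * (Γ n * (g n) ^ (κ₀ - 6)) = Γ n * (R₁ * (g n) ^ (κ₀ - 6)) := by ring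
      _ ≤ Γ n * 1 := h
      _ = Γ n := mul_one _

/-! ## (2.47) ⇒ (2.48) -/

/-- **(2.47) summed gives (2.48)** (p. 264 [22]): *"Summing over j from n to k, and then over n from 1 to k, we get
|(2.40)| ≤ 2B₁ (Σ_{n=1}^{k−1} |Γ_n| + |Γ_k∖Λ_k⁰|) ≤ 2B₁ Σ_{n=1}^{k} |Γ_n| . (2.48)"*  Typed: `Btot := Σ_{n=1}^{k}
Σ_{j=n}^{k} b j n` (the presupposed decomposition of (2.40), GAPS G-pv01-1 (i)); `V n ≥ 0` as in `Ineq247` (so the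
middle member is `2B₁ Σ_{n=1}^{k} V n`), `V n ≤ Γ n` (`|Γ_k∖Λ_k⁰| ≤ |Γ_k|`), `B₁ ≥ 0`.  Content: termwise bounds and
`inner_dyadic_le`. [cite: Balaban1988Convergent, (2.48) p.264] -/
theorem bound248_of_247 (k : ℕ) (b : ℕ → ℕ → ℝ) (V Γ : ℕ → ℝ) (B₁ : ℝ) (hB : 0 ≤ B₁)
    (hV : ∀ n, 1 ≤ n → n ≤ k → 0 ≤ V n) (hVΓ : ∀ n, 1 ≤ n → n ≤ k → V n ≤ Γ n)
    (h247 : Ineq247 b B₁ V k) :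
    |∑ n ∈ Finset.Icc 1 k, ∑ j ∈ Finset.Icc n k, b j n| ≤ 2 * B₁ * ∑ n ∈ Finset.Icc 1 k, V n ∧
      2 * B₁ * ∑ n ∈ Finset.Icc 1 k, V n ≤ 2 * B₁ * ∑ n ∈ Finset.Icc 1 k, Γ n := by
  have h2B : 0 ≤ 2 * B₁ := by positivity
  refine ⟨?_, mul_le_mul_of_nonneg_left (Finset.sum_le_sum fun n hn => ?_) h2B⟩
  · have hinner : ∀ n ∈ Finset.Icc 1 k, |∑ j ∈ Finset.Icc n k, b j n| ≤ 2 * B₁ * V n := by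
      intro n hn
      rw [Finset.mem_Icc] at hn
      have hBV : 0 ≤ B₁ * V n := mul_nonneg hB (hV n hn.1 hn.2)
      calc |∑ j ∈ Finset.Icc n k, b j n| ≤ ∑ j ∈ Finset.Icc n k, |b j n| := Finset.abs_sum_le_sum_abs _ _
        _ ≤ ∑ j ∈ Finset.Icc n k, B₁ * (2 : ℝ) ^ (-((j : ℝ) - n)) * V n := by
            refine Finset.sum_le_sum fun j hj => ?_
            rw [Finset.mem_Icc] at hj
            exact h247 n j hn.1 hj.1 hj.2
        _ = B₁ * V n * ∑ j ∈ Finset.Icc n k, (2 : ℝ) ^ (-((j : ℝ) - n)) := by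
            rw [Finset.mul_sum]
            refine Finset.sum_congr rfl fun j _ => ?_
            ring
        _ ≤ B₁ * V n * 2 := mul_le_mul_of_nonneg_left (inner_dyadic_le n k) hBV
        _ = 2 * B₁ * V n := by ring
    calc |∑ n ∈ Finset.Icc 1 k, ∑ j ∈ Finset.Icc n k, b j n|
        ≤ ∑ n ∈ Finset.Icc 1 k, |∑ j ∈ Finset.Icc n k, b j n| := Finset.abs_sum_le_sum_abs _ _
      _ ≤ ∑ n ∈ Finset.Icc 1 k, 2 * B₁ * V n := Finset.sum_le_sum hinner
      _ = 2 * B₁ * ∑ n ∈ Finset.Icc 1 k, V n := by rw [Finset.mul_sum]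
  · rw [Finset.mem_Icc] at hn
    exact hVΓ n hn.1 hn.2

/-! ## Assembly into `B14.Bounds245to249` -/

/-- **(2.45), (2.46), (2.48) at step k from the per-scale bounds**, in the shape `B14.Bounds245to249` of the sibling
module: the totals are the sums `𝐄_k = Σ_{j=1}^{k} e_j` (2.25), `𝐑_k = Σ_{j=1}^{k} r_j` (2.30), `𝐁_k = Σ_{n=1}^{k}
Σ_{j=n}^{k} b_{j,n}` ((2.40) with the presupposed decomposition); hypotheses = the instances of (2.43), (2.44) at
`Ω = Bʲ(Λ_j⁰)` (volumes majorised by `Γ n = |Γ_n|`), (2.47), the signs `E₁, R₁, B₁ ≥ 0`, `L > 1`, `0 < β`, and — for the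
(2.46) clause only, under its printed binder `κ₀ ≥ 7` — the located inputs `hsum` (T11.F) and `hsmall` ("g
sufficiently small").  This is the printed derivation pp. 263–264 with every input named; nothing of the series is
asserted. [cite: Balaban1988Convergent, (2.45)–(2.48) pp.263–264] -/
theorem bounds245to249_of_perScale (k κ₀ : ℕ) (e r : ℕ → ℝ) (b : ℕ → ℕ → ℝ) (Γ V g : ℕ → ℝ)
    (E₁ R₁ B₁ L β : ℝ) (hL : 1 < L) (hβ : 0 < β) (hE : 0 ≤ E₁) (hR : 0 ≤ R₁) (hB : 0 ≤ B₁)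
    (hΓ : ∀ n, 1 ≤ n → n ≤ k → 0 ≤ Γ n) (hV : ∀ n, 1 ≤ n → n ≤ k → 0 ≤ V n)
    (hVΓ : ∀ n, 1 ≤ n → n ≤ k → V n ≤ Γ n)
    (h243 : ∀ j, 1 ≤ j → j ≤ k → |e j| ≤ E₁ * ∑ n ∈ Finset.Icc j k, (L ^ ((j : ℝ) - n)) ^ β * Γ n)
    (h244 : ∀ j, 1 ≤ j → j ≤ k → |r j| ≤ R₁ * (g j) ^ κ₀ * ∑ n ∈ Finset.Icc j k, Γ n)
    (h247 : Ineq247 b B₁ V k)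
    (hsum : 7 ≤ κ₀ → ∀ n, 1 ≤ n → n ≤ k → ∑ j ∈ Finset.Icc 1 n, (g j) ^ κ₀ ≤ (g n) ^ (κ₀ - 6))
    (hsmall : 7 ≤ κ₀ → ∀ n, 1 ≤ n → n ≤ k → R₁ * (g n) ^ (κ₀ - 6) ≤ 1) :
    B14.Bounds245to249 (∑ j ∈ Finset.Icc 1 k, e j) (∑ j ∈ Finset.Icc 1 k, r j)
      (∑ n ∈ Finset.Icc 1 k, ∑ j ∈ Finset.Icc n k, b j n) E₁ R₁ B₁ L β g κ₀ Γ k := by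
  unfold B14.Bounds245to249
  refine ⟨?_, fun hκ => ?_, ?_⟩
  · obtain ⟨h1, h2⟩ := bound245_of_243 k e Γ E₁ L β hL hβ hE hΓ h243
    exact le_trans h1 h2
  · exact bound246_of_244 k κ₀ r Γ g R₁ hR hΓ h244 (hsum hκ) (hsmall hκ)
  · obtain ⟨h1, h2⟩ := bound248_of_247 k b V Γ B₁ hB hV hVΓ h247
    exact le_trans h1 h2

/-! ## From the run-level statements (2.43)/(2.44) to the per-scale hypotheses -/

/-- The instances of (2.43) consumed above, read off the run-level `Ineq243`: fix a run `S`, a step `k ≤ K`, for each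
`j` the printed choice of data `sel j` ("Ω = Bʲ(Λ_j⁰), φ = φ_j") and a majorant `Γ n` of the volumes `|Γ_n ∩ Ω|`
(e.g. `|Γ_n|`: `|Γ_n ∩ Ω| ≤ |Γ_n|`); then the per-scale hypothesis `h243` of `bound245_of_243` holds for
`e j := S.eTerm j k (sel j)` (the j-th summand of (2.25) by (2.26), `Λ_j⁰ ∩ Bʲ(Λ_j⁰) = Λ_j⁰`).  Uses `E₁ ≥ 0`, `L > 0`
(nonnegative weights). [cite: Balaban1988Convergent, (2.43)/(2.45) p.263] -/
theorem perScale_of_ineq243 (S : B14.Sect2Data) (L β E₁ : ℝ) (hL : 0 < L) (hE : 0 ≤ E₁)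
    (h : Ineq243 S L β E₁) (k : ℕ) (hk : k ≤ S.K) (sel : ℕ → S.Ω) (Γ : ℕ → ℝ)
    (hΓ : ∀ j n, 1 ≤ j → j ≤ n → n ≤ k → S.gammaVol n (sel j) ≤ Γ n) :
    ∀ j, 1 ≤ j → j ≤ k →
      |S.eTerm j k (sel j)| ≤ E₁ * ∑ n ∈ Finset.Icc j k, (L ^ ((j : ℝ) - n)) ^ β * Γ n := by
  intro j hj hjk
  refine le_trans (h j k (sel j) hj hjk hk) (mul_le_mul_of_nonneg_left (Finset.sum_le_sum fun n hn => ?_) hE)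
  rw [Finset.mem_Icc] at hn
  exact mul_le_mul_of_nonneg_left (hΓ j n hj hn.1 hn.2) (Real.rpow_nonneg (Real.rpow_nonneg hL.le _) _)

/-- The instances of (2.44) consumed above, read off the run-level `Ineq244` in the same way (`r j := S.rTerm j k
(sel j)`; uses `R₁ ≥ 0` and `g_j ≥ 0`, e.g. from `Setup.Flow.InInterval`). [cite: Balaban1988Convergent, (2.44)/(2.46) p.263] -/
theorem perScale_of_ineq244 (S : B14.Sect2Data) (R₁ : ℝ) (κ₀ : ℕ) (hR : 0 ≤ R₁)
    (h : Ineq244 S R₁ κ₀) (k : ℕ) (hk : k ≤ S.K) (hg : ∀ j, 1 ≤ j → j ≤ k → 0 ≤ S.flow.g j)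
    (sel : ℕ → S.Ω) (Γ : ℕ → ℝ)
    (hΓ : ∀ j n, 1 ≤ j → j ≤ n → n ≤ k → S.gammaVol n (sel j) ≤ Γ n) :
    ∀ j, 1 ≤ j → j ≤ k →
      |S.rTerm j k (sel j)| ≤ R₁ * (S.flow.g j) ^ κ₀ * ∑ n ∈ Finset.Icc j k, Γ n := by
  intro j hj hjk
  refine le_trans (h j k (sel j) hj hjk hk)
    (mul_le_mul_of_nonneg_left (Finset.sum_le_sum fun n hn => ?_) (mul_nonneg hR (pow_nonneg (hg j hj hjk) _)))
  rw [Finset.mem_Icc] at hn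
  exact hΓ j n hj hn.1 hn.2

/-- **The printed chain at run level**: for a run `S` satisfying (2.43) and (2.44) with constants `E₁, R₁ ≥ 0`
(`L > 1`, `0 < β`), a step `k ≤ K`, the printed selections `sel j` and `|Γ_n| =: Γ n ≥ |Γ_n ∩ Ω|`, the totals
`𝐄_k = Σ_j e_j`, `𝐑_k = Σ_j r_j` obey the first members of (2.45) and (2.46):
`|𝐄_k| ≤ E₁ (1 − L^{−β})^{−1} Σ_{n=1}^{k} |Γ_n|` and `|𝐑_k| ≤ R₁ Σ_{n=1}^{k} |Γ_n| Σ_{j=1}^{n} g_j^{κ₀}`. [cite: Balaban1988Convergent, (2.45)–(2.46) p.263] -/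
theorem totals_of_ineq243_244 (S : B14.Sect2Data) (L β E₁ R₁ : ℝ) (κ₀ : ℕ)
    (hL : 1 < L) (hβ : 0 < β) (hE : 0 ≤ E₁) (hR : 0 ≤ R₁)
    (h43 : Ineq243 S L β E₁) (h44 : Ineq244 S R₁ κ₀) (k : ℕ) (hk : k ≤ S.K)
    (hg : ∀ j, 1 ≤ j → j ≤ k → 0 ≤ S.flow.g j) (sel : ℕ → S.Ω) (Γ : ℕ → ℝ)
    (hΓ0 : ∀ n, 1 ≤ n → n ≤ k → 0 ≤ Γ n)
    (hΓ : ∀ j n, 1 ≤ j → j ≤ n → n ≤ k → S.gammaVol n (sel j) ≤ Γ n) :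
    |∑ j ∈ Finset.Icc 1 k, S.eTerm j k (sel j)| ≤ E₁ * (1 - L ^ (-β))⁻¹ * ∑ n ∈ Finset.Icc 1 k, Γ n ∧
      |∑ j ∈ Finset.Icc 1 k, S.rTerm j k (sel j)| ≤
        R₁ * ∑ n ∈ Finset.Icc 1 k, Γ n * ∑ j ∈ Finset.Icc 1 n, (S.flow.g j) ^ κ₀ := by
  have hL0 : 0 < L := lt_trans zero_lt_one hL
  refine ⟨?_, ?_⟩
  · obtain ⟨h1, h2⟩ := bound245_of_243 k (fun j => S.eTerm j k (sel j)) Γ E₁ L β hL hβ hE hΓ0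
      (perScale_of_ineq243 S L β E₁ hL0 hE h43 k hk sel Γ hΓ)
    exact le_trans h1 h2
  · exact bound246a_of_244 k κ₀ (fun j => S.rTerm j k (sel j)) Γ S.flow.g R₁
      (perScale_of_ineq244 S R₁ κ₀ hR h44 k hk hg sel Γ hΓ)

/-! ## (2.23) and (2.45)–(2.48) ⇒ (2.49) (revision v2, node T11.3 pass 2)

The closing sentence of the chain, p. 264 [22]: *"Finally, the vacuum energy counterterm E_k, except the terms
logarithmic in coupling constants, has the same bound as above, only with a different constant. These bounds yield the
following bounds for the effective actions A_k(1/g_k², U_k) = −A(1/g_k², U_k) + (the logarithmic terms) + O(1)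
Σ_{j=1}^{k} |Γ_j| . (2.49)"*, re-derived by kernel from the general form (2.23) of the effective action (p. 258), the
sibling module's `B14.Bounds245to249` (= (2.45), (2.46) under its printed binder κ₀ ≥ 7, (2.48)) and the quoted
vacuum-energy sentence as an EXPLICIT hypothesis (it is asserted, not derived, in §2: E_k is described on p. 262 and
defined inductively only on p. 279 — cell GAPS.md G-pv01-2).  Scalars for ONE term ({Ω_j}, {Λ_j}, {S_j}) and one
configuration.  The use of (2.49) toward (2.50) is node T11.4 (unit pv06, module `B14Cor3`); here only the pointwise
two-sided exponential form `exp_action_two_sided` (monotonicity of exp). -/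

/-- **(2.23)** p. 258 [16], verbatim: *"Now we describe the effective actions A_k. This is the most important part of
the inductive assumption. The action A_k is determined by the three sequences of sets, and it depends on the gauge
field variable V, given by (2.10), through the background field U_k(V). This field is determined by the sequence
{Ω_j}, or rather its determining set 𝐁. Let us denote the system of the fluctuation fields {A_{j−1}} by A. The effective action A_k has the following general form:
A_k(1/g_k², U_k) = −A(1/g_k², U_k) + 𝐄_k(U_k) + 𝐑_k(U_k) + 𝐁_k(U_k, A) − E_k . (2.23)"*  Typed as the scalar identity
for one term and one configuration: `Ak` = A_k(1/g_k², U_k), `Awil` = A(1/g_k², U_k) (the Wilson action with the local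
coupling (2.24)), `Etot`, `Rtot`, `Btot` = 𝐄_k(U_k), 𝐑_k(U_k), 𝐁_k(U_k, A) ((2.25), (2.30), (2.40)), `Ek` = E_k.  (The
tower-level form with the sums substituted is `…Balaban1983to89.Step.LFActionData.action23`, unit f2.) [cite: Balaban1988Convergent, (2.23) p.258] -/
def Eq223 (Ak Awil Etot Rtot Btot Ek : ℝ) : Prop :=
  Ak = -Awil + Etot + Rtot + Btot - Ek

/-- The vacuum-energy sentence p. 264 [22], verbatim: *"Finally, the vacuum energy counterterm E_k, except the terms
logarithmic in coupling constants, has the same bound as above, only with a different constant."* — "the same bound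
as above" = the right-hand sides of (2.45), (2.46), (2.48): a constant times Σ_{n=1}^{k} |Γ_n|.  E_k in §2 (p. 262
[20]): *"The constant E_k (depending on {Ω_j}, {Λ_j} also) is obtained by subtracting one-step vacuum energy
expressions, generated in small field regions, from the initial constant E. This initial constant is defined in fact
as a sum of all such expressions for all the lattices T^{(k)} as the small field regions. The constant E_1 was defined
in Sect. 1, and a general inductive definition will be given in the next section."* (p. 279 [37]: *"adding these values
to E_0^{(k)}. This yields the term E^{(k)}, and we define −E_k + E^{(k)} = −E_{k+1}."*)  Typed in the literal shape of
the sentence, as a HYPOTHESIS (asserted, not derived in print; "the terms logarithmic in coupling constants" are not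
identified in §2 — cell GAPS.md G-pv01-2): `E_k = EkLog + EkRest` with `|EkRest| ≤ E₂ Σ_{n=1}^{k} |Γ_n|`. [cite: Balaban1988Convergent, p.264 (sentence before (2.49))] -/
def VacuumRestBound (EkRest E₂ : ℝ) (Γ : ℕ → ℝ) (k : ℕ) : Prop :=
  |EkRest| ≤ E₂ * ∑ n ∈ Finset.Icc 1 k, Γ n

/-- **(2.49)** p. 264 [22], verbatim: *"These bounds yield the following bounds for the effective actions
A_k(1/g_k², U_k) = −A(1/g_k², U_k) + (the logarithmic terms) + O(1) Σ_{j=1}^{k} |Γ_j| . (2.49) The first term on the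
right-hand side yields the small factors for large field characteristic functions. It also controls the logarithmic
terms."*  Typed reading of the displayed "=" with "O(1)": the remainder `A_k + A(1/g_k², U_k) − (the logarithmic
terms)` is bounded in absolute value by `C Σ_{j=1}^{k} |Γ_j|` for a constant `C` (fixed before k, the sequences and
U_k); `logTerms` = "(the logarithmic terms)". [cite: Balaban1988Convergent, (2.49) p.264] -/
def Ineq249 (Ak Awil logTerms C : ℝ) (Γ : ℕ → ℝ) (k : ℕ) : Prop :=
  |Ak + Awil - logTerms| ≤ C * ∑ n ∈ Finset.Icc 1 k, Γ n

/-- *"These bounds yield"* (2.49), KERNEL-CHECKED: from (2.23) with `E_k = EkLog + EkRest`, the bounds (2.45), (2.46)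
(under its printed binder `κ₀ ≥ 7`, which delivers `|𝐑_k| ≤ Σ_{n=1}^{k} |Γ_n|`), (2.48) in the shape
`B14.Bounds245to249`, and the vacuum-energy hypothesis `VacuumRestBound`, the inequality (2.49) holds with
"(the logarithmic terms)" `= −EkLog` and the explicit constant `O(1) = E₁ (1 − L^{−β})^{−1} + 1 + 2B₁ + E₂`.
Content: the triangle inequality. [cite: Balaban1988Convergent, (2.49) p.264] -/
theorem ineq249_of_223 (k κ₀ : ℕ) (hκ : 7 ≤ κ₀) (Ak Awil Etot Rtot Btot EkLog EkRest : ℝ)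
    (E₁ R₁ B₁ L β E₂ : ℝ) (g Γ : ℕ → ℝ)
    (h223 : Eq223 Ak Awil Etot Rtot Btot (EkLog + EkRest))
    (hB : B14.Bounds245to249 Etot Rtot Btot E₁ R₁ B₁ L β g κ₀ Γ k)
    (hvac : VacuumRestBound EkRest E₂ Γ k) :
    Ineq249 Ak Awil (-EkLog) (E₁ * (1 - L ^ (-β))⁻¹ + 1 + 2 * B₁ + E₂) Γ k := by
  unfold Ineq249
  unfold Eq223 at h223
  unfold VacuumRestBound at hvac
  unfold B14.Bounds245to249 at hB
  obtain ⟨hE, hR, hBt⟩ := hB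
  obtain ⟨hR1, hR2⟩ := hR hκ
  have hRt : |Rtot| ≤ ∑ n ∈ Finset.Icc 1 k, Γ n := le_trans hR1 hR2
  have hsum : Ak + Awil - -EkLog = Etot + Rtot + Btot - EkRest := by
    rw [h223]
    ring
  rw [hsum]
  have key : |Etot + Rtot + Btot - EkRest| ≤ |Etot| + |Rtot| + |Btot| + |EkRest| := by
    refine abs_le.mpr ⟨?_, ?_⟩
    · linarith [neg_abs_le Etot, neg_abs_le Rtot, neg_abs_le Btot, le_abs_self EkRest]
    · linarith [le_abs_self Etot, le_abs_self Rtot, le_abs_self Btot, neg_abs_le EkRest]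
  calc |Etot + Rtot + Btot - EkRest| ≤ |Etot| + |Rtot| + |Btot| + |EkRest| := key
    _ ≤ E₁ * (1 - L ^ (-β))⁻¹ * ∑ n ∈ Finset.Icc 1 k, Γ n + ∑ n ∈ Finset.Icc 1 k, Γ n
          + 2 * B₁ * ∑ n ∈ Finset.Icc 1 k, Γ n + E₂ * ∑ n ∈ Finset.Icc 1 k, Γ n := by
        linarith
    _ = (E₁ * (1 - L ^ (-β))⁻¹ + 1 + 2 * B₁ + E₂) * ∑ n ∈ Finset.Icc 1 k, Γ n := by ring

/-- The complete printed chain of pp. 263–264 in one statement: the instances of (2.43), (2.44) (volumes majorised by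
`Γ n = |Γ_n|`), (2.47), the located inputs of (2.46) (`hsum`, `hsmall`, under `κ₀ ≥ 7`), the form (2.23) and the
vacuum-energy hypothesis give (2.49) with the explicit constant.  Composition of `bounds245to249_of_perScale` and
`ineq249_of_223`; nothing of the series is asserted. [cite: Balaban1988Convergent, (2.43)–(2.49) pp.263–264] -/
theorem ineq249_of_perScale (k κ₀ : ℕ) (hκ : 7 ≤ κ₀) (e r : ℕ → ℝ) (b : ℕ → ℕ → ℝ) (Γ V g : ℕ → ℝ)
    (E₁ R₁ B₁ L β E₂ : ℝ) (hL : 1 < L) (hβ : 0 < β) (hE : 0 ≤ E₁) (hR : 0 ≤ R₁) (hB : 0 ≤ B₁)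
    (hΓ : ∀ n, 1 ≤ n → n ≤ k → 0 ≤ Γ n) (hV : ∀ n, 1 ≤ n → n ≤ k → 0 ≤ V n)
    (hVΓ : ∀ n, 1 ≤ n → n ≤ k → V n ≤ Γ n)
    (h243 : ∀ j, 1 ≤ j → j ≤ k → |e j| ≤ E₁ * ∑ n ∈ Finset.Icc j k, (L ^ ((j : ℝ) - n)) ^ β * Γ n)
    (h244 : ∀ j, 1 ≤ j → j ≤ k → |r j| ≤ R₁ * (g j) ^ κ₀ * ∑ n ∈ Finset.Icc j k, Γ n)
    (h247 : Ineq247 b B₁ V k)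
    (hsum : ∀ n, 1 ≤ n → n ≤ k → ∑ j ∈ Finset.Icc 1 n, (g j) ^ κ₀ ≤ (g n) ^ (κ₀ - 6))
    (hsmall : ∀ n, 1 ≤ n → n ≤ k → R₁ * (g n) ^ (κ₀ - 6) ≤ 1)
    (Ak Awil EkLog EkRest : ℝ)
    (h223 : Eq223 Ak Awil (∑ j ∈ Finset.Icc 1 k, e j) (∑ j ∈ Finset.Icc 1 k, r j)
      (∑ n ∈ Finset.Icc 1 k, ∑ j ∈ Finset.Icc n k, b j n) (EkLog + EkRest))
    (hvac : VacuumRestBound EkRest E₂ Γ k) :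
    Ineq249 Ak Awil (-EkLog) (E₁ * (1 - L ^ (-β))⁻¹ + 1 + 2 * B₁ + E₂) Γ k :=
  ineq249_of_223 k κ₀ hκ Ak Awil _ _ _ EkLog EkRest E₁ R₁ B₁ L β E₂ g Γ h223
    (bounds245to249_of_perScale k κ₀ e r b Γ V g E₁ R₁ B₁ L β hL hβ hE hR hB hΓ hV hVΓ h243 h244 h247
      (fun _ => hsum) (fun _ => hsmall)) hvac

/-- How (2.49) is consumed pointwise on the way to (2.50) (p. 264: *"The first term on the right-hand side yields the
small factors for large field characteristic functions. It also controls the logarithmic terms. Thus we estimate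
the integral ∫dV_k ρ_k by a sum of terms …"*): for ONE term, `exp A_k` lies between
`exp(−A(1/g_k², U_k) + (log terms) ∓ C Σ_{n=1}^{k} |Γ_n|)`.  Monotonicity of `exp` only; the sum over terms, the
comparison of `Σ |Γ_n|` with `|T_η|`, the control of the logarithmic terms and both halves of (2.50) are node T11.4
(cell GAPS.md G-r2.5, G-adv3-1, G-adv3-2), not here. [cite: Balaban1988Convergent, (2.49)–(2.50) p.264] -/
theorem exp_action_two_sided (Ak Awil logTerms C : ℝ) (Γ : ℕ → ℝ) (k : ℕ)
    (h : Ineq249 Ak Awil logTerms C Γ k) :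
    Real.exp (-Awil + logTerms - C * ∑ n ∈ Finset.Icc 1 k, Γ n) ≤ Real.exp Ak ∧
      Real.exp Ak ≤ Real.exp (-Awil + logTerms + C * ∑ n ∈ Finset.Icc 1 k, Γ n) := by
  unfold Ineq249 at h
  obtain ⟨h1, h2⟩ := abs_le.mp h
  constructor
  · apply Real.exp_le_exp.mpr
    linarith
  · apply Real.exp_le_exp.mpr
    linarith

end Literature.MathematicalPhysics.QuantumFieldTheory.Balaban1983to89.B14Thm2
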